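import Summits.CriticalPhenomena.PercolationContinuityZ3.Theorems.PercNearOneGluingNoHeavyLowerTailOneLayerTwoFingerHub
import HarnessLib

/-!
# `NoHeavyLowerTail` (stmt-CriticalPhenomena-4575), |A| = 5 rung — one-layer observer-relays: the REGIME form (part 4)

Support file (prover prim-cplus-engine gen 11; `--supports stmt-CriticalPhenomena-4575`).  Parts 1–3
(`…OneLayerTwoFingerTools/Core/Hub`) prove `X′(5)@o` for one-layer observer-relays under the hair condition
`(1−h_a)(1−h_b)(1−h_c)(1−h_d) ≤ 1/4`.  Here the hair condition is derived from the REGIME hypothesis of `X′(5)`/`C6`,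
`Σ_{x ∈ {a,b,c,d}} μ(o ↔ x) > 3` (= `Σ_{x ∈ A} μ(o ↔ x) > 4` with `o ∈ A`): for a one-layer `o` every `{o ↔ x}` lies,
off a null set, in `{some hair is open}`, whose probability is `1 − Πq`; so `3 < Σ_x μ(o↔x) ≤ 4(1 − Πq)`.
Main statement: `oneLayer_twoFingerHub_glued_of_regime`.
[cite: KozmaNitzan2024, Lemma 5 (p. 13) and Thm. 4 (pp. 12–14)]
-/

noncomputable section

namespace Summit.CriticalPhenomena.PercolationContinuityZ3.Theorems

open MeasureTheory Set Literature.Probability.Percolation Literature.Probability.Percolation.KNPreFKG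
open Literature.Probability.LatticeModels (prodBernoulli)
open OneLayerTwoFinger

namespace OneLayerTwoFinger

variable {V : Type*} [Fintype V] [DecidableEq V]

/-- **One-layer reach bound**: for a one-layer observer `o` with targets `a,b,c,d` and any `x ≠ o`,
`μ(o ↔ x) ≤ 1 − (1−h_a)(1−h_b)(1−h_c)(1−h_d)` (an open path from `o` starts with an open hair, off the null set of
open weight-0 pairs). [cite: KozmaNitzan2024, Lemma 5 (p. 13)] -/
theorem oneLayer_openConn_le (w : Sym2 V → unitInterval) (o a b c d x : V) (hxo : x ≠ o)
    (hab : a ≠ b) (hac : a ≠ c) (had : a ≠ d) (hbc : b ≠ c) (hbd : b ≠ d) (hcd : c ≠ d)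
    (hiso : ∀ u, u ≠ o → u ≠ a → u ≠ b → u ≠ c → u ≠ d → w s(o, u) = 0) :
    (prodBernoulli w).real (openConn o x) ≤
      1 - (1 - (w s(o, a) : ℝ)) * (1 - w s(o, b)) * (1 - w s(o, c)) * (1 - w s(o, d)) := by
  classical
  set μ := prodBernoulli w with hμ
  haveI : IsProbabilityMeasure μ := by rw [hμ]; infer_instance
  set F : Finset (Sym2 V) := {s(o, a), s(o, b), s(o, c), s(o, d)} with hF
  set G0 : Set (BondConfig V) := {ω | ∀ u, u ≠ o → u ≠ a → u ≠ b → u ≠ c → u ≠ d → s(o, u) ∉ ω} with hG0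
  set Cl : Set (BondConfig V) := {ω | ∀ e ∈ F, e ∉ ω} with hCl
  -- the null set
  have hG0c : μ.real G0ᶜ = 0 := by
    set U : Finset V := Finset.univ.filter fun u => u ≠ o ∧ u ≠ a ∧ u ≠ b ∧ u ≠ c ∧ u ≠ d with hU
    have hsub : G0ᶜ ⊆ ⋃ u ∈ U, {ω : BondConfig V | s(o, u) ∈ ω} := by
      intro ω hω
      simp only [hG0, mem_compl_iff, mem_setOf_eq, not_forall, not_not, exists_prop] at hω
      obtain ⟨u, huo, hua, hub, huc, hud, hu⟩ := hω
      simp only [mem_iUnion, mem_setOf_eq, exists_prop]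
      exact ⟨u, by simp [hU, huo, hua, hub, huc, hud], hu⟩
    refine le_antisymm ?_ measureReal_nonneg
    calc μ.real G0ᶜ ≤ μ.real (⋃ u ∈ U, {ω : BondConfig V | s(o, u) ∈ ω}) :=
          measureReal_mono hsub (measure_ne_top μ _)
      _ ≤ ∑ u ∈ U, μ.real {ω : BondConfig V | s(o, u) ∈ ω} := measureReal_biUnion_finset_le U _
      _ = 0 := by
        refine Finset.sum_eq_zero fun u hu => ?_
        simp only [hU, Finset.mem_filter, Finset.mem_univ, true_and] at hu
        rw [hμ, Literature.Probability.LatticeModels.prodBernoulli_real_setOf_mem,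
          hiso u hu.1 hu.2.1 hu.2.2.1 hu.2.2.2.1 hu.2.2.2.2]
        rfl
  -- `{o ↔ x} ∩ G0 ⊆ Clᶜ`
  have hsub : (openConn o x : Set (BondConfig V)) ⊆ Clᶜ ∪ G0ᶜ := by
    intro ω hω
    by_cases hG : ω ∈ G0
    · left
      intro hCl'
      have hG' : ∀ u, u ≠ o → u ≠ a → u ≠ b → u ≠ c → u ≠ d → s(o, u) ∉ ω := hG
      obtain ⟨u, hu, huo, hou, -⟩ := exists_hair_of_openConn hxo hG' hω
      have hmem : s(o, u) ∈ F := by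
        rcases hu with rfl | rfl | rfl | rfl <;> simp [hF]
      exact hCl' _ hmem hou
    · exact Or.inr hG
  have hClval : μ.real Cl = (1 - (w s(o, a) : ℝ)) * (1 - w s(o, b)) * (1 - w s(o, c)) * (1 - w s(o, d)) := by
    rw [hCl, hμ, Literature.Probability.LatticeModels.prodBernoulli_real_forall_notMem, hF]
    have h1 : s(o, a) ∉ ({s(o, b), s(o, c), s(o, d)} : Finset (Sym2 V)) := by
      simp only [Finset.mem_insert, Finset.mem_singleton, Sym2.congr_right]; push Not; exact ⟨hab, hac, had⟩
    have h2 : s(o, b) ∉ ({s(o, c), s(o, d)} : Finset (Sym2 V)) := by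
      simp only [Finset.mem_insert, Finset.mem_singleton, Sym2.congr_right]; push Not; exact ⟨hbc, hbd⟩
    have h3 : s(o, c) ∉ ({s(o, d)} : Finset (Sym2 V)) := by
      simp only [Finset.mem_singleton, Sym2.congr_right]; exact hcd
    rw [Finset.prod_insert h1, Finset.prod_insert h2, Finset.prod_insert h3, Finset.prod_singleton]
    ring
  have hcompl : μ.real Clᶜ = 1 - μ.real Cl := by
    have := measureReal_add_measureReal_compl (μ := μ) (s := Cl) MeasurableSet.of_discrete
    rw [probReal_univ] at this
    linarith
  calc μ.real (openConn o x) ≤ μ.real (Clᶜ ∪ G0ᶜ) := measureReal_mono hsub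
    _ ≤ μ.real Clᶜ + μ.real G0ᶜ := measureReal_union_le _ _
    _ = 1 - (1 - (w s(o, a) : ℝ)) * (1 - w s(o, b)) * (1 - w s(o, c)) * (1 - w s(o, d)) := by
      rw [hG0c, add_zero, hcompl, hClval]

/-- **Regime ⇒ hair condition**: for a one-layer observer `o` with targets `a,b,c,d`, if
`Σ_{x ∈ {a,b,c,d}} μ(o ↔ x) > 3` then `(1−h_a)(1−h_b)(1−h_c)(1−h_d) < 1/4`. [cite: KozmaNitzan2024, Lemma 5 (p. 13)] -/
theorem oneLayer_hairProd_lt_quarter (w : Sym2 V → unitInterval) (o a b c d : V)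
    (hao : a ≠ o) (hbo : b ≠ o) (hco : c ≠ o) (hdo : d ≠ o)
    (hab : a ≠ b) (hac : a ≠ c) (had : a ≠ d) (hbc : b ≠ c) (hbd : b ≠ d) (hcd : c ≠ d)
    (hiso : ∀ u, u ≠ o → u ≠ a → u ≠ b → u ≠ c → u ≠ d → w s(o, u) = 0)
    (hreg : 3 < (prodBernoulli w).real (openConn o a) + (prodBernoulli w).real (openConn o b) +
      (prodBernoulli w).real (openConn o c) + (prodBernoulli w).real (openConn o d)) :
    (1 - (w s(o, a) : ℝ)) * (1 - w s(o, b)) * (1 - w s(o, c)) * (1 - w s(o, d)) < 1 / 4 := by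
  have ha := oneLayer_openConn_le w o a b c d a hao hab hac had hbc hbd hcd hiso
  have hb := oneLayer_openConn_le w o a b c d b hbo hab hac had hbc hbd hcd hiso
  have hc := oneLayer_openConn_le w o a b c d c hco hab hac had hbc hbd hcd hiso
  have hd := oneLayer_openConn_le w o a b c d d hdo hab hac had hbc hbd hcd hiso
  linarith

end OneLayerTwoFinger

/-- **`X′(5)@o` / `C6` for one-layer observer-relays, REGIME form.**  `μ = prodBernoulli w` on a finite vertex type;
`o` an observer-relay with the four other relays `a, b, c, d` (distinct, `≠ o`) and every other pair at `o` of weight `0`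
(one-layer).  If `Σ_{x ∈ {a,b,c,d}} μ(o ↔ x) > 3` (the regime `E N > 4` of the |A| = 5 one-cut rung, `o ∈ A`), then some
`x ∈ {a,b,c,d}` has `μ(o ↔ x) ≤ μ(some two of a,b,c,d are both joined to o)`; equivalently
`μ(N′ ≤ 1) ≤ max_x μ(o ↮ x)`, the two-finger hub bound `X′(5)` at `a = o` (prim-a5/ASSEMBLY.md §8, `TwoFingerHub`)
for every one-layer observer-relay — the `K₅`-corner regime where the hypothesis-free form fails.
[cite: KozmaNitzan2024, Lemma 5 (p. 13) and Thm. 4 (pp. 12–14)] -/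
theorem oneLayer_twoFingerHub_glued_of_regime {V : Type*} [Fintype V] [DecidableEq V]
    (w : Sym2 V → unitInterval) (o a b c d : V)
    (hao : a ≠ o) (hbo : b ≠ o) (hco : c ≠ o) (hdo : d ≠ o)
    (hab : a ≠ b) (hac : a ≠ c) (had : a ≠ d) (hbc : b ≠ c) (hbd : b ≠ d) (hcd : c ≠ d)
    (hiso : ∀ u, u ≠ o → u ≠ a → u ≠ b → u ≠ c → u ≠ d → w s(o, u) = 0)
    (hreg : 3 < (prodBernoulli w).real (openConn o a) + (prodBernoulli w).real (openConn o b) +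
      (prodBernoulli w).real (openConn o c) + (prodBernoulli w).real (openConn o d)) :
    ∃ x, (x = a ∨ x = b ∨ x = c ∨ x = d) ∧
      (prodBernoulli w).real (openConn o x) ≤
        (prodBernoulli w).real {ω : BondConfig V |
          (ω ∈ openConn o a ∧ ω ∈ openConn o b) ∨ (ω ∈ openConn o a ∧ ω ∈ openConn o c) ∨
          (ω ∈ openConn o a ∧ ω ∈ openConn o d) ∨ (ω ∈ openConn o b ∧ ω ∈ openConn o c) ∨
          (ω ∈ openConn o b ∧ ω ∈ openConn o d) ∨ (ω ∈ openConn o c ∧ ω ∈ openConn o d)} :=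
  oneLayer_twoFingerHub_glued w o a b c d hao hbo hco hdo hab hac had hbc hbd hcd hiso
    (le_of_lt (OneLayerTwoFinger.oneLayer_hairProd_lt_quarter w o a b c d hao hbo hco hdo hab hac had hbc hbd hcd
      hiso hreg))

end Summit.CriticalPhenomena.PercolationContinuityZ3.Theorems

end
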